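import Summits.ValiantsHypothesis.ValiantsHypothesis.Theorems.KPlusLogSqLawTropicalBBoardLaw

/-!
# Route «KPlusLogSqLaw», crux `TropicalB` (stmt-ValiantsHypothesis-19771) — RELATIVE SLOPE COUNTING:
# slope counting holds fibrewise over EVERY partition of the classes — `≤ 1 + Σ_t (multichoose(a_t, #T_t) − 1)` terms per part-board

HONEST FRAMING.  Third sequel of `…TropicalBBoardLaw` (seat val-sym-trop-p3 g18, cell `pub-symmetroid`, 2026-08-29; `--supports
stmt-ValiantsHypothesis-19771 --as helper`).  A STRUCTURE law for dominant chains of an ARBITRARY design (any format `(m, K)`, exponents,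
valuations, support), unifying the tree's slope counting (`TropicalCensus.tropRootLawAt_slopeCount`: `n + 1 ≤ multichoose K m`, the case of ONE
part) with this seat's board / multi-board laws (parts of two classes: `m + 1` per board).  It bounds nothing for `TropicalB` in its window and
bears on neither `WeakLifting`, DoorA26 / DoorA34, `MatrixDescartes` (stmt-ValiantsHypothesis-18050) nor VP ≠ VNP.

THE LAW.  Partition the classes by any map `π : Fin K → Fin r` (part `t` has the alphabet `π⁻¹ t` of `a_t` classes).  The PART-BOARD of a term
`(σ, λ)` is `t ↦ (T_t, σ(T_t))` with `T_t = {i : π (λ i) = t}`.  Along a dominant chain (strictly increasing integer slopes, consecutive terms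
distinct):
* `BoardLaw.sl_mem_partValues`, `BoardLaw.card_partValues_le` — the `T`-slope of a term whose classes on `T` lie in part `t` is a sum of `d`
  over a multiset of size `#T` from the part alphabet, and there are at most `multichoose a_t #T` such sums (`Sym.card_sym_eq_multichoose`).
* `BoardLaw.card_filter_partBoard_le` — **at most `1 + Σ_t (multichoose a_t #T_t − 1)` terms share a part-board**.  Proof: inside the fibre
  each part is a restricted optimum with a common image, so each part-slope is weakly increasing in time (`IntervalOpt.sl_le_of_inOpt`) and
  strictly on a part where the terms differ (`IntervalOpt.sl_lt_of_inOpt`; distinct chain terms differ on some part since the parts cover the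
  columns); the rank-sum of the part-slopes inside their value sets is a strictly increasing potential bounded by `Σ_t (#values_t − 1)`.
* `BoardLaw.succ_le_sum_partBoards` — **`n + 1 ≤ Σ_{β visited} (1 + Σ_t (multichoose a_t #T_t(β) − 1))`**.
Instances (docstring only; the named cases live in the cited files): `r = 1` ⇒ one part-board ⇒ `n + 1 ≤ multichoose K m` (slope counting);
all parts of size `≤ 2` ⇒ `≤ m + 1` per board (`…TropicalBBoardLawPairs`); parts of size three ⇒ `≤ 1 + Σ_t (C(#T_t + 2, 2) − 1)` per board.

READING (located, nothing claimed).  The crux's slope-class counting is the COARSEST member of a family indexed by class partitions; every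
finer member trades a smaller per-board budget for the number of part-boards the chain visits — a long chain in the window must either use
many classes per part or re-distribute its columns (with their rows) among the parts very often.  [this cell; comparison lemmas = the tree's
`…TropicalBIntervalOpt`, counting = `Sym.card_sym_eq_multichoose` (Mathlib)]
-/

set_option linter.dupNamespace false
set_option autoImplicit false

namespace Summit.ValiantsHypothesis.ValiantsHypothesis.Theorems.KPlusLogSqLaw

open Summit.ValiantsHypothesis.ValiantsHypothesis.Theorems.MatrixDescartes.Negative
open Summit.ValiantsHypothesis.ValiantsHypothesis.Theorems.LacunarySymmetroidMatrixDescartes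
open scoped BigOperators
open Finset

namespace BoardLaw

variable {m K r : ℕ}

/-- the part-slope value set: sums of `d` over multisets of size `c` drawn from the classes of part `t`. -/
theorem sl_mem_partValues (d : Fin K → ℕ) (π : Fin K → Fin r) (t : Fin r) (J : Finset (Fin m))
    (q : Equiv.Perm (Fin m) × (Fin m → Fin K)) (h : ∀ i ∈ J, π (q.2 i) = t) :
    IntervalOpt.sl d J q ∈ (univ : Finset (Sym {l : Fin K // π l = t} J.card)).image
      (fun s : Sym {l : Fin K // π l = t} J.card =>
        ((s : Multiset {l : Fin K // π l = t}).map fun l : {l : Fin K // π l = t} => (d l.1 : ℤ)).sum) := by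
  classical
  refine mem_image.2 ⟨⟨J.attach.val.map fun i => ⟨q.2 i.1, h i.1 i.2⟩, ?_⟩, mem_univ _, ?_⟩
  · rw [Multiset.card_map, card_val, card_attach]
  · show ((J.attach.val.map fun i => (⟨q.2 i.1, h i.1 i.2⟩ : {l : Fin K // π l = t})).map fun l => (d l.1 : ℤ)).sum =
      IntervalOpt.sl d J q
    unfold IntervalOpt.sl
    rw [Multiset.map_map, ← sum_attach J]
    rfl

/-- that value set has at most `multichoose (#part alphabet) #J` elements. [folklore] -/
theorem card_partValues_le (d : Fin K → ℕ) (π : Fin K → Fin r) (t : Fin r) (c : ℕ) :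
    ((univ : Finset (Sym {l : Fin K // π l = t} c)).image
      (fun s : Sym {l : Fin K // π l = t} c =>
        ((s : Multiset {l : Fin K // π l = t}).map fun l : {l : Fin K // π l = t} => (d l.1 : ℤ)).sum)).card ≤
      Nat.multichoose (univ.filter fun l : Fin K => π l = t).card c := by
  classical
  refine card_image_le.trans ?_
  rw [card_univ, Sym.card_sym_eq_multichoose, Fintype.card_subtype]

section Partition

variable (d : Fin K → ℕ) (v ε : Fin m → Fin m → Fin K → ℤ) {n : ℕ} (θ : Fin (n + 1) → ℤ)
  (p : Fin (n + 1) → Equiv.Perm (Fin m) × (Fin m → Fin K)) (π : Fin K → Fin r)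

/-- **RELATIVE SLOPE COUNTING (fibre form).**  Partition the classes by `π : Fin K → Fin r`; the PART-BOARD of a term assigns to every part `t`
the set `T_t` of columns whose class lies in part `t` together with its row image.  Along a dominant chain (strictly increasing integer slopes,
consecutive terms distinct) the number of terms sharing a given part-board `β` is at most
`1 + Σ_t (multichoose (#classes of part t) (#T_t) − 1)`:
slope counting holds FIBREWISE, part by part (inside the fibre each part is a restricted optimum with a common image, so each part-slope is weakly
increasing in time, strictly where the part changes; the part-slope depends only on the class multiset of the part; rank-sum potential).
For `r = 1` this is the tree's slope counting `n + 1 ≤ multichoose K m` (`TropicalCensus.tropRootLawAt_slopeCount`); for parts of two classes it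
is the multi-board law `≤ m + 1` of `…TropicalBBoardLawPairs`. [this cell] -/
theorem card_filter_partBoard_le (hθ : StrictMono θ) (hdom : ∀ k, IsDominant d v ε (θ k) (p k))
    (hne : ∀ k : Fin n, p k.castSucc ≠ p k.succ) (β : Fin r → Finset (Fin m) × Finset (Fin m)) :
    (univ.filter fun k => (fun t => ((univ.filter fun i => π ((p k).2 i) = t),
        (univ.filter fun i => π ((p k).2 i) = t).image (p k).1)) = β).card ≤
      1 + ∑ t, (Nat.multichoose (univ.filter fun l : Fin K => π l = t).card (β t).1.card - 1) := by
  classical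
  set Tp : Fin (n + 1) → Fin r → Finset (Fin m) := fun k t => univ.filter fun i => π ((p k).2 i) = t with hTp
  set F := univ.filter fun k => (fun t => (Tp k t, (Tp k t).image (p k).1)) = β with hF
  show F.card ≤ 1 + ∑ t, (Nat.multichoose (univ.filter fun l : Fin K => π l = t).card (β t).1.card - 1)
  have hmem : ∀ k ∈ F, ∀ t, Tp k t = (β t).1 ∧ (β t).1.image (p k).1 = (β t).2 := by
    intro k hk t
    have h := congrFun (mem_filter.1 hk).2 t
    have h1 : Tp k t = (β t).1 := congrArg Prod.fst h
    refine ⟨h1, ?_⟩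
    have h2 := congrArg Prod.snd h
    rw [h1] at h2
    exact h2
  have hcls : ∀ k ∈ F, ∀ t, ∀ i ∈ (β t).1, π ((p k).2 i) = t := by
    intro k hk t i hi
    rw [← (hmem k hk t).1] at hi
    exact (mem_filter.1 hi).2
  have hcover : ∀ k ∈ F, ∀ i, i ∈ (β (π ((p k).2 i))).1 := by
    intro k hk i
    rw [← (hmem k hk _).1]
    exact mem_filter.2 ⟨mem_univ _, rfl⟩
  have hopt : ∀ k (J : Finset (Fin m)), IntervalOpt.InOpt d v ε J (θ k) (p k) := fun k J =>
    IntervalOpt.inOpt_mono (subset_univ J) (IntervalOpt.inOpt_univ_of_isDominant (hdom k))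
  have himg : ∀ k ∈ F, ∀ k' ∈ F, ∀ t, (β t).1.image (p k).1 = (β t).1.image (p k').1 := fun k hk k' hk' t => by
    rw [(hmem k hk t).2, (hmem k' hk' t).2]
  -- value sets
  set W : Fin r → Finset ℤ := fun t => (univ : Finset (Sym {l : Fin K // π l = t} (β t).1.card)).image
      (fun s : Sym {l : Fin K // π l = t} (β t).1.card =>
        ((s : Multiset {l : Fin K // π l = t}).map fun l : {l : Fin K // π l = t} => (d l.1 : ℤ)).sum) with hW
  have hslW : ∀ k ∈ F, ∀ t, IntervalOpt.sl d (β t).1 (p k) ∈ W t := fun k hk t =>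
    sl_mem_partValues d π t (β t).1 (p k) (hcls k hk t)
  have hWle : ∀ t, (W t).card ≤ Nat.multichoose (univ.filter fun l : Fin K => π l = t).card (β t).1.card := fun t =>
    card_partValues_le d π t (β t).1.card
  set Φ : Fin (n + 1) → ℕ := fun k => ∑ t, ((W t).filter (· < IntervalOpt.sl d (β t).1 (p k))).card with hΦ
  have hΦle : ∀ k ∈ F, Φ k ≤ ∑ t, (Nat.multichoose (univ.filter fun l : Fin K => π l = t).card (β t).1.card - 1) := by
    intro k hk
    refine sum_le_sum fun t _ => ?_
    have hss : (W t).filter (· < IntervalOpt.sl d (β t).1 (p k)) ⊂ W t :=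
      (ssubset_iff_of_subset (filter_subset _ _)).2 ⟨_, hslW k hk t, by rw [mem_filter]; exact fun h => lt_irrefl _ h.2⟩
    have h1 := card_lt_card hss
    have h2 := hWle t
    omega
  have hslope := slope_strictMono_of_chainD d v ε θ p hθ hdom hne
  have hΦlt : ∀ k ∈ F, ∀ k' ∈ F, k < k' → Φ k < Φ k' := by
    intro k hk k' hk' hkk'
    have hdiff : ∃ t, IntervalOpt.restr (β t).1 (p k) ≠ IntervalOpt.restr (β t).1 (p k') := by
      by_contra hall
      push Not at hall
      apply (hslope.injective.ne (ne_of_lt hkk'))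
      show TropicalCensus.slope d (p k) = TropicalCensus.slope d (p k')
      have hpp : p k = p k' := by
        refine Prod.ext (Equiv.ext fun i => ?_) (funext fun i => ?_)
        · exact (IntervalOpt.restr_eq_iff.1 (hall _) i (hcover k hk i)).1
        · exact (IntervalOpt.restr_eq_iff.1 (hall _) i (hcover k hk i)).2
      rw [hpp]
    obtain ⟨t₀, ht₀⟩ := hdiff
    have hle : ∀ t, ((W t).filter (· < IntervalOpt.sl d (β t).1 (p k))).card ≤
        ((W t).filter (· < IntervalOpt.sl d (β t).1 (p k'))).card := by
      intro t
      refine card_le_card fun x hx => ?_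
      rw [mem_filter] at hx ⊢
      exact ⟨hx.1, lt_of_lt_of_le hx.2
        (IntervalOpt.sl_le_of_inOpt (hopt k _) (hopt k' _) (himg k hk k' hk' t) (hθ hkk').le)⟩
    have hlt : ((W t₀).filter (· < IntervalOpt.sl d (β t₀).1 (p k))).card <
        ((W t₀).filter (· < IntervalOpt.sl d (β t₀).1 (p k'))).card := by
      refine card_lt_card ((ssubset_iff_of_subset fun x hx => ?_).2 ⟨IntervalOpt.sl d (β t₀).1 (p k), ?_, ?_⟩)
      · rw [mem_filter] at hx ⊢
        exact ⟨hx.1, lt_of_lt_of_le hx.2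
          (IntervalOpt.sl_le_of_inOpt (hopt k _) (hopt k' _) (himg k hk k' hk' t₀) (hθ hkk').le)⟩
      · rw [mem_filter]
        exact ⟨hslW k hk t₀, IntervalOpt.sl_lt_of_inOpt (hopt k _) (hopt k' _) (himg k hk k' hk' t₀) (hθ hkk') ht₀⟩
      · rw [mem_filter]; exact fun h => lt_irrefl _ h.2
    calc Φ k = ∑ t, ((W t).filter (· < IntervalOpt.sl d (β t).1 (p k))).card := rfl
      _ < ∑ t, ((W t).filter (· < IntervalOpt.sl d (β t).1 (p k'))).card :=
          sum_lt_sum (fun t _ => hle t) ⟨t₀, mem_univ _, hlt⟩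
  have hinj : Set.InjOn Φ F := by
    intro k hk k' hk' h
    by_contra hkk
    rcases lt_or_gt_of_ne hkk with hlt | hlt
    · exact absurd h (hΦlt k hk k' hk' hlt).ne
    · exact absurd h.symm (hΦlt k' hk' k hk hlt).ne
  set M := ∑ t, (Nat.multichoose (univ.filter fun l : Fin K => π l = t).card (β t).1.card - 1) with hM
  calc F.card = (F.image Φ).card := (card_image_of_injOn hinj).symm
    _ ≤ (range (M + 1)).card := card_le_card fun x hx => by
        obtain ⟨k, hk, rfl⟩ := mem_image.1 hx
        exact mem_range.2 (Nat.lt_succ_of_le (hΦle k hk))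
    _ = 1 + M := by rw [card_range, add_comm]

/-- **RELATIVE SLOPE COUNTING.**  `n + 1 ≤ Σ_{β visited} (1 + Σ_t (multichoose (#classes of part t) (#T_t(β)) − 1))`: the length of a dominant
chain is at most the sum, over the part-boards it visits, of the fibrewise slope-counting budgets. [this cell] -/
theorem succ_le_sum_partBoards (hθ : StrictMono θ) (hdom : ∀ k, IsDominant d v ε (θ k) (p k))
    (hne : ∀ k : Fin n, p k.castSucc ≠ p k.succ) :
    n + 1 ≤ ∑ β ∈ univ.image (fun k : Fin (n + 1) => fun t => ((univ.filter fun i => π ((p k).2 i) = t),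
        (univ.filter fun i => π ((p k).2 i) = t).image (p k).1)),
      (1 + ∑ t, (Nat.multichoose (univ.filter fun l : Fin K => π l = t).card (β t).1.card - 1)) := by
  classical
  set mb : Fin (n + 1) → (Fin r → Finset (Fin m) × Finset (Fin m)) := fun k t =>
    ((univ.filter fun i => π ((p k).2 i) = t), (univ.filter fun i => π ((p k).2 i) = t).image (p k).1) with hmb
  have hsum := card_eq_sum_card_image mb (univ : Finset (Fin (n + 1)))
  have hcard : (univ : Finset (Fin (n + 1))).card = n + 1 := by rw [card_univ, Fintype.card_fin]
  calc n + 1 = (univ : Finset (Fin (n + 1))).card := hcard.symm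
    _ = ∑ β ∈ univ.image mb, (univ.filter fun k => mb k = β).card := hsum
    _ ≤ _ := sum_le_sum fun β _ => card_filter_partBoard_le d v ε θ p π hθ hdom hne β

end Partition

end BoardLaw

end Summit.ValiantsHypothesis.ValiantsHypothesis.Theorems.KPlusLogSqLaw
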